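import Summits.Ventures.PercRepro.ProfilePointedCircuitClassesStarSharpD0Q

/-!
# PercRepro — CASE D0 OF `StarNineSharp`, PART R: REGIME (i) MODULO THE BOUND ON THE `ef`-PLANE DEMANDS
(p5, gen 54; `proofs/P5-GM1.md` §81 ADD 1–4)

`inCount_thru_le_of_no_on_line_e_of_H_bound`: with no ON line through `e` (ON lines elsewhere allowed) the
`b′`-avoiding inequality follows from the rules R0 (`d0_injR0`), R2′ (`d0_injR2''`), R3′ (`d0_injR3'`) and ONE
hypothesis `hHcls`: the demands on the `ef`-planes (`¬ d0c0 ∧ ¬ d0c1`) are at most the bi-bases whose pair is not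
an ON demand plus the ON sets `{e, f, x} + b`. The rule R4a′ (`d0_injR4a'`, module D0Q) covers the `d0c4'` part of
that class; the R4b″ part (≤ 3 demands in `T = H ∩ X`; §81 ADD 3–4) is what a successor must add to discharge `hHcls`.
-/

open scoped Matroid

namespace PercRepro.Cogirth

open Finset ThmH Skew Shadow Profile

open Classical

variable {α : Type} [DecidableEq α] {N : Matroid α} [N.Finite]

section StarSharpD0R

variable {b b' : α}

/-- **REGIME (i) MODULO THE `ef`-PLANE BOUND**: no ON line through `e`; the demands on the `ef`-planes are
bounded by `hHcls`; then the `b′`-avoiding inequality holds. -/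
theorem inCount_thru_le_of_no_on_line_e_of_H_bound (hn : (gr N).card = 9) (hR : rk N (gr N) = 5)
    (hcf : ∀ x ∈ gr N, rk N ((gr N).erase x) = 5) (h : SeriesPair N b b')
    {e f : α} (he : e ∈ gr N) (hf : f ∈ gr N) (hef : e ≠ f) (heb : e ≠ b) (heb' : e ≠ b') (hfb : f ≠ b) (hfb' : f ≠ b')
    (hE7 : rk N (((gr N).erase b).erase b') = 4)
    (hnle : ∀ S : Finset α, S ⊆ ((gr N).erase b).erase b' → e ∈ S → rk N (insert b (insert b' S)) ≤ 3 → rk N S ≤ 1)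
    (he1 : ∀ y ∈ ((((gr N).erase b).erase b').erase f).erase e, rk N {e, y} = 2)
    (hfc : ∀ y ∈ ((((gr N).erase b).erase b').erase f).erase e, rk N (((((gr N).erase b).erase b').erase f).erase y) = 4)
    (hX : rk N (((((gr N).erase b).erase b').erase f).erase e) = 4)
    (hHcls : ((d0DON N b' e f).filter (fun W => ¬ d0c0 N b b' e f W ∧ ¬ d0c1 N b e f W)).card ≤
      ((biIndepSets N 4).filter (fun B => ((f ∈ B ∧ b' ∉ B) ∧ (e ∈ B ∧ b ∉ B)) ∧
        ¬ (insert b (B.erase f) ∈ biIndepSets N 4 ∧ rk N (insert b (insert b' (B.erase f))) = 4))).card +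
      ((biIndepSets N 4).filter (fun W => (f ∈ W ∧ b' ∉ W) ∧
        (e ∈ W ∧ b ∈ W ∧ ¬ (gr N \ W).erase b' ∈ biIndepSets N 4))).card) :
    inCount N 4 e + thruCount N 4 {b', f} + thruCount N 4 {b', e, f} ≤
      inCount N 4 f + thruCount N 4 {e, f} + thruCount N 4 {b', e} := by
  rw [inCount_thru_split']
  have hsplit := card_filter_add_card_filter_not (s := (biIndepSets N 4).filter (fun W => (e ∈ W ∧ f ∉ W) ∧ b' ∉ W))
    (fun W => (gr N \ W).erase b' ∈ biIndepSets N 4)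
  simp only [filter_filter] at hsplit
  have htar : ((biIndepSets N 4).filter (fun W => (f ∈ W ∧ b' ∉ W) ∧ (e ∉ W ∧ (gr N \ W).erase b' ∈ biIndepSets N 4))).card +
      ((biIndepSets N 4).filter (fun W => (f ∈ W ∧ b' ∉ W) ∧ (e ∉ W ∧ b ∈ W ∧ ¬ (gr N \ W).erase b' ∈ biIndepSets N 4))).card +
      ((biIndepSets N 4).filter (fun W => (f ∈ W ∧ b' ∉ W) ∧ (e ∈ W ∧ b ∉ W))).card +
      ((biIndepSets N 4).filter (fun W => (f ∈ W ∧ b' ∉ W) ∧ (e ∈ W ∧ b ∈ W ∧ (gr N \ W).erase b' ∈ biIndepSets N 4))).card +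
      ((biIndepSets N 4).filter (fun W => (f ∈ W ∧ b' ∉ W) ∧ (e ∈ W ∧ b ∈ W ∧ ¬ (gr N \ W).erase b' ∈ biIndepSets N 4))).card ≤
      ((biIndepSets N 4).filter (fun W => f ∈ W ∧ b' ∉ W)).card := by
    rw [← card_union_of_disjoint, ← card_union_of_disjoint, ← card_union_of_disjoint, ← card_union_of_disjoint]
    · apply card_le_card
      intro W hW
      simp only [mem_union, mem_filter] at hW ⊢
      rcases hW with (((hW | hW) | hW) | hW) | hW <;> exact ⟨hW.1, hW.2.1⟩
    · rw [disjoint_union_left, disjoint_union_left, disjoint_union_left]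
      refine ⟨⟨⟨?_, ?_⟩, ?_⟩, ?_⟩ <;> rw [disjoint_filter]
      · rintro W _ ⟨-, heW, -⟩ ⟨-, heW', -, -⟩; exact heW heW'
      · rintro W _ ⟨-, heW, -, -⟩ ⟨-, heW', -, -⟩; exact heW heW'
      · rintro W _ ⟨-, -, hbW⟩ ⟨-, -, hbW', -⟩; exact hbW hbW'
      · rintro W _ ⟨-, -, -, hc⟩ ⟨-, -, -, hc'⟩; exact hc' hc
    · rw [disjoint_union_left, disjoint_union_left]
      refine ⟨⟨?_, ?_⟩, ?_⟩ <;> rw [disjoint_filter]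
      · rintro W _ ⟨-, heW, -⟩ ⟨-, heW', -, -⟩; exact heW heW'
      · rintro W _ ⟨-, heW, -, -⟩ ⟨-, heW', -, -⟩; exact heW heW'
      · rintro W _ ⟨-, -, hbW⟩ ⟨-, -, hbW', -⟩; exact hbW hbW'
    · rw [disjoint_union_left]
      refine ⟨?_, ?_⟩ <;> rw [disjoint_filter]
      · rintro W _ ⟨-, heW, -⟩ ⟨-, heW', -⟩; exact heW heW'
      · rintro W _ ⟨-, heW, -, -⟩ ⟨-, heW', -⟩; exact heW heW'
    · rw [disjoint_filter]
      rintro W _ ⟨-, -, hc⟩ ⟨-, -, -, hc'⟩; exact hc' hc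
  have hinj1 := card_off_demands_le (N := N) (b' := b') (e := e) hf hfb'
  have hs1 := card_filter_add_card_filter_not (s := d0DON N b' e f) (fun W => d0c0 N b b' e f W)
  have hs1' := card_filter_add_card_filter_not (s := (d0DON N b' e f).filter (fun W => ¬ d0c0 N b b' e f W))
    (fun W => d0c1 N b e f W)
  have hs2 := card_filter_add_card_filter_not
    (s := ((d0DON N b' e f).filter (fun W => ¬ d0c0 N b b' e f W)).filter (fun W => d0c1 N b e f W))
    (fun W => d0c2 N b b' e f W)
  simp only [filter_filter] at hs1' hs2
  -- the bi-basis kind, split by «the pair is an ON demand»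
  have hsB := card_filter_add_card_filter_not
    (s := (biIndepSets N 4).filter (fun W => (f ∈ W ∧ b' ∉ W) ∧ (e ∈ W ∧ b ∉ W)))
    (fun B => insert b (B.erase f) ∈ biIndepSets N 4 ∧ rk N (insert b (insert b' (B.erase f))) = 4)
  simp only [filter_filter] at hsB
  have hinjR0 := d0_injR0 h hn he hf hef heb heb' hfb hfb'
  have hinjR2 := d0_injR2'' hn h he hf hef heb heb' hfb hfb'
  have hinjR3 := d0_injR3' hn hR hcf h he hf hef heb heb' hfb hfb' hE7 hnle he1 hfc hX
  have hDON : (d0DON N b' e f).card = ((biIndepSets N 4).filter (fun W => ((e ∈ W ∧ f ∉ W) ∧ b' ∉ W) ∧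
      ¬ (gr N \ W).erase b' ∈ biIndepSets N 4)).card := rfl
  rw [← hDON] at hsplit
  omega

/-- **REGIME (i) MODULO THE R4b′ BOUND**: the `ef`-plane bound `hHcls` follows from `d0_injR4a'` (module D0Q) and a
bound of the R4b′ class (`¬ d0c0 ∧ ¬ d0c1 ∧ ¬ d0c4'`) by the ON sets `{e, f, x} + b` alone. (This form is FALSE in
the type-δ configurations of §81 ADD 3 — class 166 — where one R4b′ demand must take an R4c bi-basis; there the
joint hypothesis of `inCount_thru_le_of_no_on_line_e_of_H_bound` is the one to discharge.) -/
theorem inCount_thru_le_of_no_on_line_e_of_R4b_bound (hn : (gr N).card = 9) (hR : rk N (gr N) = 5)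
    (hcf : ∀ x ∈ gr N, rk N ((gr N).erase x) = 5) (h : SeriesPair N b b')
    {e f : α} (he : e ∈ gr N) (hf : f ∈ gr N) (hef : e ≠ f) (heb : e ≠ b) (heb' : e ≠ b') (hfb : f ≠ b) (hfb' : f ≠ b')
    (hE7 : rk N (((gr N).erase b).erase b') = 4)
    (hnle : ∀ S : Finset α, S ⊆ ((gr N).erase b).erase b' → e ∈ S → rk N (insert b (insert b' S)) ≤ 3 → rk N S ≤ 1)
    (he1 : ∀ y ∈ ((((gr N).erase b).erase b').erase f).erase e, rk N {e, y} = 2)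
    (hfc : ∀ y ∈ ((((gr N).erase b).erase b').erase f).erase e, rk N (((((gr N).erase b).erase b').erase f).erase y) = 4)
    (hX : rk N (((((gr N).erase b).erase b').erase f).erase e) = 4) (hef2 : rk N {e, f} = 2)
    (hR4b : ((d0DON N b' e f).filter (fun W => (¬ d0c0 N b b' e f W ∧ ¬ d0c1 N b e f W) ∧ ¬ d0c4' N b b' e f W)).card ≤
      ((biIndepSets N 4).filter (fun W => (f ∈ W ∧ b' ∉ W) ∧
        (e ∈ W ∧ b ∈ W ∧ ¬ (gr N \ W).erase b' ∈ biIndepSets N 4))).card) :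
    inCount N 4 e + thruCount N 4 {b', f} + thruCount N 4 {b', e, f} ≤
      inCount N 4 f + thruCount N 4 {e, f} + thruCount N 4 {b', e} := by
  apply inCount_thru_le_of_no_on_line_e_of_H_bound hn hR hcf h he hf hef heb heb' hfb hfb' hE7 hnle he1 hfc hX
  have hs4 := card_filter_add_card_filter_not
    (s := (d0DON N b' e f).filter (fun W => ¬ d0c0 N b b' e f W ∧ ¬ d0c1 N b e f W)) (fun W => d0c4' N b b' e f W)
  simp only [filter_filter] at hs4
  have hinjR4a := d0_injR4a' hn hR h he hf hef heb heb' hfb hfb' hE7 hnle hef2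
  omega

/-- **EVERY ON RANK-3 SET THROUGH `e, f` LIES IN `H`** (no ON line THROUGH `e` suffices: an ON plane `S ⊄ H` through
`e, f` would meet the ON plane `H` in the line `ef`, an ON line through `e`). -/
theorem subset_H_of_on_ef' (h : SeriesPair N b b') (hR : rk N (gr N) = 5)
    (hE7 : rk N (((gr N).erase b).erase b') = 4) {e f : α}
    (hnle : ∀ S : Finset α, S ⊆ ((gr N).erase b).erase b' → e ∈ S → rk N (insert b (insert b' S)) ≤ 3 → rk N S ≤ 1)
    (hef2 : rk N {e, f} = 2) {H : Finset α} (hH : H ⊆ ((gr N).erase b).erase b') (heH : e ∈ H) (hfH : f ∈ H)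
    (hHon : rk N (insert b (insert b' H)) = 4)
    (hHfl : ∀ z ∈ ((gr N).erase b).erase b', z ∉ H → rk N (insert z H) = 4)
    {S : Finset α} (hS : S ⊆ ((gr N).erase b).erase b') (heS : e ∈ S) (hfS : f ∈ S)
    (hSon : rk N (insert b (insert b' S)) = 4) : S ⊆ H := by
  have hU3 : rk N (S ∪ H) ≤ 3 := by
    have hle : rk N (S ∪ H) ≤ 4 := by
      have h1 : rk N (S ∪ H) ≤ rk N (((gr N).erase b).erase b') := rk_mono' (M := N) (union_subset hS hH)
      omega
    by_contra hne
    have hU : rk N (S ∪ H) = 4 := by omega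
    have hI := rk_inter_le_one_of_two_on_e h hR hnle hS hH heS heH hSon hHon hU
    have h2 : rk N {e, f} ≤ rk N (S ∩ H) := rk_mono' (M := N) (by
      intro x hx; simp only [mem_insert, mem_singleton] at hx
      rcases hx with rfl | rfl
      · exact mem_inter.2 ⟨heS, heH⟩
      · exact mem_inter.2 ⟨hfS, hfH⟩)
    omega
  intro z hz
  by_contra hzH
  have h4 := hHfl z (hS hz) hzH
  have h5 : rk N (insert z H) ≤ rk N (S ∪ H) :=
    rk_mono' (M := N) (insert_subset (mem_union_left _ hz) subset_union_right)
  omega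

/-- **THE `ef`-PLANE DEMANDS LIE IN `H`** (regime (i)): a demand `π + e + b` with `¬ d0c1` has `ρ(π + e + f) = 3`
and `π + e ⊆ H`. -/
theorem d0_demand_class' (h : SeriesPair N b b') (hR : rk N (gr N) = 5) (hE7 : rk N (((gr N).erase b).erase b') = 4)
    {e f : α} (he : e ∈ gr N) (hf : f ∈ gr N) (heb : e ≠ b) (heb' : e ≠ b') (hfb : f ≠ b) (hfb' : f ≠ b')
    (hnle : ∀ S : Finset α, S ⊆ ((gr N).erase b).erase b' → e ∈ S → rk N (insert b (insert b' S)) ≤ 3 → rk N S ≤ 1)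
    (hef2 : rk N {e, f} = 2)
    {H : Finset α} (hH : H ⊆ ((gr N).erase b).erase b') (heH : e ∈ H) (hfH : f ∈ H)
    (hHon : rk N (insert b (insert b' H)) = 4)
    (hHfl : ∀ z ∈ ((gr N).erase b).erase b', z ∉ H → rk N (insert z H) = 4) :
    ∀ π : Finset α, π ⊆ ((((gr N).erase b).erase b').erase f).erase e → rk N (insert e π) = 3 →
      rk N (insert b (insert b' (insert e π))) = 4 → ¬ rk N (insert f (insert e π)) = 4 →
      rk N (insert f (insert e π)) = 3 ∧ insert e π ⊆ H := by
  have hXE : ((((gr N).erase b).erase b').erase f).erase e ⊆ ((gr N).erase b).erase b' :=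
    (erase_subset _ _).trans (erase_subset _ _)
  have heE : e ∈ ((gr N).erase b).erase b' := mem_erase.2 ⟨heb', mem_erase.2 ⟨heb, he⟩⟩
  have hfE : f ∈ ((gr N).erase b).erase b' := mem_erase.2 ⟨hfb', mem_erase.2 ⟨hfb, hf⟩⟩
  intro π hπX hYr hYon hne4
  have hfY3 : rk N (insert f (insert e π)) = 3 := rk_insert_ef_eq_three_of_not_c1 he hf hπX hYr hne4
  refine ⟨hfY3, ?_⟩
  have hS := subset_H_of_on_ef' h hR hE7 hnle hef2 hH heH hfH hHon hHfl
    (S := insert f (insert e π)) (insert_subset hfE (insert_subset heE (hπX.trans hXE)))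
    (mem_insert_of_mem (mem_insert_self _ _)) (mem_insert_self _ _)
    (on_insert_f_of_on hf hfb hfb' hYr hfY3 hYon)
  exact (subset_insert _ _).trans hS

end StarSharpD0R

end PercRepro.Cogirth
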